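import Mathlib.NumberTheory.NumberField.InfinitePlace.Embeddings
import Mathlib.FieldTheory.PrimitiveElement
import Mathlib.RingTheory.Ideal.Norm.AbsNorm
import Mathlib.RingTheory.Localization.Integral
import Mathlib.LinearAlgebra.Dual.Lemmas
import Mathlib.Algebra.Polynomial.FieldDivision
import Mathlib.Algebra.Algebra.Hom.Rat
import Mathlib.Algebra.Order.Group.Multiset
import Mathlib.RingTheory.MvPolynomial.Basic
import Mathlib.Data.Complex.Basic
import HarnessLib

/-!
# Booker–Krishnamurthy 2011, Lemma 5.3: inverting the archimedean monomials by finitely many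
# `λ ≡ 1 (mod 𝔮)`

A. R. Booker, M. Krishnamurthy, *A strengthening of the GL(2) converse theorem*, Compositio Math.
147 (2011), 669–715 [BookerKrishnamurthy2011], §5.4, Lemma 5.3 (p. 694) and its proof (pp. 694–695),
read on the held text `paper:doi-10-1112-s0010437x10005087` (PDF pp. 27–28). This is one of the
leaves of the printed proof of Theorem 1.1 (the `GL(2)` converse theorem with unramified twists),
hence of Corollary 1.2 (the named fact
`Literature.NumberTheory.Automorphic.bookerKrishnamurthy_isPiOfArtinRep_of_entire_twists` of
`Automorphic/BookerKrishnamurthyConverse`); it is the step that lets the authors pass from the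
linear combinations (5.9)–(5.11) over a finite set `T` of multipliers `λ ∈ (1 + 𝔮) ∩ F^×` to a
single monomial `μ₀` in (5.12). Everything here is PROVED; no definition and no named fact is
introduced.

Printed statement (p. 694). For `v` real let `μ_v(y) = y^{m_v/2}` (`m_v ∈ 2ℤ_{≥0}`), for `v` complex
`μ_v(y) = y^{(m_v+n_v)/2} ȳ^{(m_v-n_v)/2}`, `μ = ∏_{v ∣ ∞} μ_v : F_∞^× → ℂ^×`, "a monomial of total
degree `deg(μ)` in the `[F : ℚ]` variables `y_v` for `v ∈ S_ℝ` and `y_v, ȳ_v` for `v ∈ S_ℂ`"; `R_M` is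
the set of all such `μ` with `deg(μ) < M`; `𝔮` is a non-zero integral ideal (the conductor ideal of
§5.2).

> **Lemma 5.3.** Let `M ∈ ℤ_{≥ 0}` and `μ₀ ∈ R_M`. Then there is a finite subset
> `T ⊂ (1 + 𝔮) ∩ F^×` and coefficients `c_λ ∈ ℂ` for each `λ ∈ T` such that
> `∑_{λ ∈ T} c_λ μ(λ)⁻¹ = 1` if `μ = μ₀`, `= 0` if `μ ≠ μ₀`, for all `μ ∈ R_M`.

Rendering. The `[F : ℚ]` variables `(y_v)_{v real}, (y_v, ȳ_v)_{v complex}` evaluated at `λ ∈ F`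
are exactly the values `τ(λ)` at the `[F : ℚ]` complex embeddings `τ : F →+* ℂ` (Mathlib
`NumberField.Embeddings`), so a monomial `μ` is an exponent vector `μ : (F →+* ℂ) → ℕ` acting by
`μ(λ) = ∏_τ τ(λ)^{μ τ}`, of total degree `∑_τ μ τ`, and `μ(λ)⁻¹ = (∏_τ τ(λ)^{μ τ})⁻¹`. We prove the
statement for an ARBITRARY finite set `R` of exponent vectors containing `μ₀`
(`BookerKrishnamurthy.exists_finset_sum_mul_inv_monomial_eq_ite`), which is equivalent to the
printed one (`R_M` is finite, and any finite `R` lies in some `R_M`), and then specialise to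
`R = R_M` (`BookerKrishnamurthy.lemma_5_3`).

Proof. The paper argues: `S = {τ(λ⁻¹) : λ ∈ (1 + 𝔮) ∩ F^×}` is Zariski dense in `ℂ^{[F:ℚ]}`, so the
functions `f_λ : μ ↦ μ(λ⁻¹)` span `ℂ^{R_M}` (a functional vanishing on all `f_λ` is a polynomial
vanishing on `S`). We keep the second half verbatim (`exists_finsupp_combination_eq_ite_of_linearIndependent`:
a linearly independent finite family of functions admits, for each index, a finite combination of
point evaluations picking it out — duality in `ℂ^R`, Mathlib `Submodule.exists_dual_map_eq_bot_of_lt_top`)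
and replace the Zariski-density half by a shorter road available in Mathlib: `(1 + 𝔮) ∖ {0}` is a
multiplicative monoid on which each `λ ↦ μ(λ)⁻¹` is a character, distinct exponent vectors give
distinct characters (evaluate along `λ = 1 + m N b`, `m ∈ ℕ`, `N = 𝔑(𝔮) ∈ 𝔮`, `b` an integral
primitive element, and compare root multiplicities of the resulting one-variable polynomials
`∏_τ (1 + m N τ(b))^{μ τ}` — the `τ(b)` are pairwise distinct), and distinct characters of a monoid
are linearly independent (Dedekind–Artin, Mathlib `linearIndependent_monoidHom`). The paper's
density statement is then recovered as a COROLLARY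
(`BookerKrishnamurthy.mvPolynomial_eq_zero_of_forall_eval_inv_embedding_eq_zero`).

## References

* A. R. Booker, M. Krishnamurthy, Compositio Math. 147 (2011), §5.4, Lemma 5.3 and proof,
  pp. 694–695. [BookerKrishnamurthy2011]
* E. Artin, *Galois Theory* (1944), Thm. 12 (independence of characters); Mathlib
  `linearIndependent_monoidHom`.

## Mathlib / tree search

`lean search 'linearIndependent_monoidHom|exists_primitive_element|absNorm_mem'`: Mathlib only;
`lean search 'BookerKrishnamurthy|lemma_5_3|inv_monomial'`: nothing relevant in Literature besides
the three `BookerKrishnamurthyConverse*` files (statement, arch-parameter proofs, `F = ℚ` proofs).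
-/

noncomputable section

open scoped NumberField Polynomial Classical
open NumberField Polynomial Finset

namespace Literature.NumberTheory.Automorphic

namespace BookerKrishnamurthy

universe u

variable {F : Type u} [Field F] [NumberField F]

/-! ### Linear algebra: picking out one member of an independent family by point evaluations -/

/-- If finitely many functions `g i : X → L` (`i ∈ ι`) are linearly independent over the field
`L`, then for each `i₀` there is a finitely supported family of coefficients `c : X →₀ L` with
`∑_x c_x g_i(x) = δ_{i,i₀}` for all `i` — the evaluation vectors `(g_i(x))_i`, `x ∈ X`, span
`L^ι`, since a functional vanishing on all of them is a linear relation among the `g_i`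
(Booker–Krishnamurthy 2011, proof of Lemma 5.3, second paragraph: "consider the vector space `V`
of functions `f : R_M → ℂ` … if `V' ≠ V`, then there is a non-zero linear functional …").
[cite: BookerKrishnamurthy2011, Lemma 5.3 (proof, p. 695)] -/
theorem exists_finsupp_combination_eq_ite_of_linearIndependent {ι X L : Type*} [Fintype ι]
    [DecidableEq ι] [Field L] {g : ι → X → L} (hg : LinearIndependent L g) (i₀ : ι) :
    ∃ c : X →₀ L, ∀ i, (c.sum fun x a => a * g i x) = if i = i₀ then 1 else 0 := by
  classical
  -- the evaluation vectors
  set w : X → ι → L := fun x i => g i x with hw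
  have hspan : Submodule.span L (Set.range w) = ⊤ := by
    by_contra hne
    obtain ⟨φ, hφ, hφ0⟩ := Submodule.exists_dual_map_eq_bot_of_lt_top
      (lt_top_iff_ne_top.mpr hne) inferInstance
    have hwx : ∀ x, φ (w x) = 0 := fun x => by
      have hx : φ (w x) ∈ (Submodule.span L (Set.range w)).map φ :=
        Submodule.mem_map_of_mem (Submodule.subset_span ⟨x, rfl⟩)
      rwa [hφ0, Submodule.mem_bot] at hx
    -- the coefficients of `φ` in the dual basis
    set a : ι → L := fun i => φ fun j => if i = j then 1 else 0 with ha
    have hφv : ∀ v : ι → L, φ v = ∑ i, v i * a i := fun v => by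
      rw [LinearMap.pi_apply_eq_sum_univ φ v]
      simp [ha]
    have hrel : ∑ i, a i • g i = 0 := by
      funext x
      have h := hwx x
      rw [hφv] at h
      simpa [Finset.sum_apply, hw, mul_comm] using h
    have ha0 : ∀ i, a i = 0 := Fintype.linearIndependent_iff.mp hg a hrel
    apply hφ
    refine LinearMap.ext fun v => ?_
    rw [hφv, LinearMap.zero_apply]
    exact Finset.sum_eq_zero fun i _ => by rw [ha0, mul_zero]
  have hmem : (fun i => if i = i₀ then (1 : L) else 0) ∈ Submodule.span L (Set.range w) := by
    rw [hspan]; exact Submodule.mem_top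
  obtain ⟨c, hc⟩ := Finsupp.mem_span_range_iff_exists_finsupp.mp hmem
  refine ⟨c, fun i => ?_⟩
  have h := congrFun hc i
  simpa [Finsupp.sum, Finset.sum_apply, hw] using h

/-! ### An integral primitive element separating the complex embeddings -/

/-- There is a non-zero algebraic integer `b ∈ 𝓞 F` generating `F` over `ℚ` on which the complex
embeddings of `F` take pairwise distinct values (primitive element theorem, cleared of
denominators; distinct `ℚ`-algebra maps differ on a generator). [folklore] -/
theorem exists_ringOfIntegers_embeddings_injective :
    ∃ b : 𝓞 F, (b : F) ≠ 0 ∧ ∀ τ σ : F →+* ℂ, τ b = σ b → τ = σ := by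
  -- a non-zero primitive element
  obtain ⟨θ, hθ, hθ0⟩ : ∃ θ : F, IntermediateField.adjoin ℚ {θ} = ⊤ ∧ θ ≠ 0 := by
    obtain ⟨θ₀, hθ₀⟩ := Field.exists_primitive_element ℚ F
    by_cases h0 : θ₀ = 0
    · refine ⟨1, ?_, one_ne_zero⟩
      have hbot : IntermediateField.adjoin ℚ {(0 : F)} = ⊥ :=
        IntermediateField.adjoin_simple_eq_bot_iff.mpr (zero_mem _)
      have htop : (⊤ : IntermediateField ℚ F) = ⊥ := by rw [← hθ₀, h0, hbot]
      refine le_antisymm le_top ?_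
      rw [htop]
      exact bot_le
    · exact ⟨θ₀, hθ₀, h0⟩
  -- clear denominators
  have halg : IsAlgebraic ℤ θ :=
    (IsFractionRing.isAlgebraic_iff ℤ ℚ F).mpr (Algebra.IsAlgebraic.isAlgebraic θ)
  obtain ⟨m, b, hm, hmb⟩ := IsAlgebraic.exists_nsmul_eq (S := 𝓞 F) halg
  have hb : (b : F) = (m : F) * θ := by
    rw [← nsmul_eq_mul, hmb]
  refine ⟨b, ?_, fun τ σ hτσ => ?_⟩
  · rw [hb]
    exact mul_ne_zero (by exact_mod_cast hm) hθ0
  -- `ℚ⟮b⟯ = ⊤`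
  have hθmem : θ ∈ IntermediateField.adjoin ℚ {(b : F)} := by
    have h1 : θ = (m : ℚ)⁻¹ • (b : F) := by
      rw [hb, Algebra.smul_def, map_inv₀, map_natCast, ← mul_assoc,
        inv_mul_cancel₀ (by exact_mod_cast hm : (m : F) ≠ 0), one_mul]
    rw [h1]
    exact IntermediateField.smul_mem _ (IntermediateField.mem_adjoin_simple_self ℚ (b : F))
  have htop : IntermediateField.adjoin ℚ {(b : F)} = ⊤ := by
    refine le_antisymm le_top ?_
    rw [← hθ]
    exact IntermediateField.adjoin_simple_le_iff.mpr hθmem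
  have hadj : Algebra.adjoin ℚ {(b : F)} = ⊤ := by
    rw [← IntermediateField.adjoin_simple_toSubalgebra_of_isAlgebraic
      (Algebra.IsAlgebraic.isAlgebraic (R := ℚ) (b : F)), htop, IntermediateField.top_toSubalgebra]
  -- distinct embeddings differ on `b`
  have h' : τ.toRatAlgHom = σ.toRatAlgHom :=
    AlgHom.ext_of_adjoin_eq_top hadj fun x hx => by
      rw [Set.mem_singleton_iff] at hx
      subst hx
      simpa using hτσ
  have h'' := congrArg (fun f : F →ₐ[ℚ] ℂ => (f : F →+* ℂ)) h'
  simpa using h''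

/-! ### Distinct monomials are distinct, and independent, on `(1 + 𝔮) ∖ {0}` -/

/-- Root multiplicities of `∏_τ (a_τ X + 1)^{e_τ}` for pairwise distinct non-zero `a_τ`: the
multiplicity of the root `-a_σ⁻¹` is `e_σ`. [folklore] -/
theorem count_roots_prod_pow_linear {ι : Type*} [Fintype ι] [DecidableEq ι] {a : ι → ℂ}
    (ha : ∀ i, a i ≠ 0) (hinj : Function.Injective a) (e : ι → ℕ) (σ : ι) :
    (∏ i, (C (a i) * X + C 1) ^ e i).roots.count (-(a σ)⁻¹) = e σ := by
  have hne : ∀ i, (C (a i) * X + C 1) ^ e i ≠ 0 := fun i =>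
    pow_ne_zero _ fun h => by
      have := congrArg (Polynomial.eval 0) h
      simp at this
  have hcount : ∀ i, (((C (a i) * X + C 1) ^ e i).roots).count (-(a σ)⁻¹) =
      if σ = i then e σ else 0 := fun i => by
    rw [roots_pow, Multiset.count_nsmul, roots_C_mul_X_add_C (1 : ℂ) (ha i), mul_one,
      Multiset.count_singleton]
    by_cases h : σ = i
    · subst h; simp
    · rw [if_neg, mul_zero, if_neg h]
      intro h'
      exact h (hinj (inv_injective (neg_injective h')))
  rw [roots_prod _ _ (Finset.prod_ne_zero_iff.mpr fun i _ => hne i), Multiset.count_bind]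
  simp_rw [hcount]
  rw [← Finset.sum_eq_multiset_sum]
  simp

/-- **Distinct exponent vectors give distinct monomial functions on `(1 + 𝔮) ∖ {0}`.** For a
non-zero ideal `𝔮 ⊆ 𝓞 F` and exponent vectors `e ≠ e'` on the complex embeddings of `F` there is
`λ ∈ 1 + 𝔮`, `λ ≠ 0`, with `∏_τ τ(λ)^{e_τ} ≠ ∏_τ τ(λ)^{e'_τ}` (evaluate along `λ = 1 + m 𝔑(𝔮) b`,
`m ∈ ℕ`, `b` as in `exists_ringOfIntegers_embeddings_injective`, and compare root multiplicities of
the polynomials `∏_τ (1 + m 𝔑(𝔮) τ(b))^{e_τ}` in `m`; replaces the Zariski-density step of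
Booker–Krishnamurthy 2011, proof of Lemma 5.3, first paragraph). [folklore] -/
theorem exists_mem_oneAddIdeal_prod_pow_ne {q : Ideal (𝓞 F)} (hq : q ≠ ⊥)
    {e e' : (F →+* ℂ) → ℕ} (hee' : e ≠ e') :
    ∃ x : F, x ≠ 0 ∧ (∃ a ∈ q, x = 1 + (a : F)) ∧
      ∏ τ : F →+* ℂ, τ x ^ e τ ≠ ∏ τ : F →+* ℂ, τ x ^ e' τ := by
  classical
  obtain ⟨b, hb0, hbinj⟩ := exists_ringOfIntegers_embeddings_injective (F := F)
  set N : ℕ := Ideal.absNorm q with hN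
  have hN0 : N ≠ 0 := by
    rw [hN, Ne, Ideal.absNorm_eq_zero_iff]; exact hq
  have hNmem : (N : 𝓞 F) ∈ q := Ideal.absNorm_mem q
  -- the evaluation points `λ_m = 1 + m N b`
  set lam : ℕ → F := fun m => 1 + (m : F) * ((N : F) * b) with hlam
  have hlam_mem : ∀ m, ∃ a ∈ q, lam m = 1 + (a : F) := fun m =>
    ⟨(m : 𝓞 F) * ((N : 𝓞 F) * b), q.mul_mem_left _ (q.mul_mem_right _ hNmem), by
      simp [hlam]⟩
  -- the one-variable polynomials
  set a : (F →+* ℂ) → ℂ := fun τ => (N : ℂ) * τ b with ha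
  have ha0 : ∀ τ, a τ ≠ 0 := fun τ =>
    mul_ne_zero (by exact_mod_cast hN0) ((map_ne_zero τ).mpr hb0)
  have hainj : Function.Injective a := fun τ σ h =>
    hbinj τ σ (mul_left_cancel₀ (by exact_mod_cast hN0 : (N : ℂ) ≠ 0) h)
  set P : ((F →+* ℂ) → ℕ) → ℂ[X] := fun f => ∏ τ, (C (a τ) * X + C 1) ^ f τ with hP
  have hPeval : ∀ (f : (F →+* ℂ) → ℕ) (m : ℕ),
      (P f).eval (m : ℂ) = ∏ τ : F →+* ℂ, τ (lam m) ^ f τ := fun f m => by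
    simp only [hP, eval_prod, eval_pow, eval_add, eval_mul, eval_C, eval_X]
    refine Finset.prod_congr rfl fun τ _ => ?_
    simp only [hlam, ha, map_add, map_one, map_mul, map_natCast]
    ring
  -- if the two monomials agreed at every admissible `λ_m`, the polynomials would coincide
  by_contra hcon
  push Not at hcon
  have hbad : Set.Subsingleton {m : ℕ | lam m = 0} := by
    intro m hm m' hm'
    simp only [Set.mem_setOf_eq, hlam] at hm hm'
    have hc : (N : F) * b ≠ 0 := mul_ne_zero (by exact_mod_cast hN0) hb0
    have h : (m : F) * ((N : F) * b) = (m' : F) * ((N : F) * b) := by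
      rw [← add_right_inj (1 : F), hm, hm']
    exact_mod_cast mul_right_cancel₀ hc h
  have hgood : Set.Infinite {m : ℕ | lam m ≠ 0} := by
    have : {m : ℕ | lam m ≠ 0} = {m : ℕ | lam m = 0}ᶜ := by ext; simp
    rw [this]
    exact hbad.finite.infinite_compl
  have hinf : Set.Infinite ((fun m : ℕ => (m : ℂ)) '' {m : ℕ | lam m ≠ 0}) :=
    hgood.image (Nat.cast_injective (R := ℂ)).injOn
  have hPP : P e = P e' := by
    apply eq_of_infinite_eval_eq
    refine Set.Infinite.mono ?_ hinf
    rintro _ ⟨m, hm, rfl⟩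
    rw [Set.mem_setOf_eq, hPeval, hPeval]
    exact hcon (lam m) hm (hlam_mem m)
  apply hee'
  funext σ
  have h := congrArg (fun p : ℂ[X] => p.roots.count (-(a σ)⁻¹)) hPP
  simpa only [hP, count_roots_prod_pow_linear ha0 hainj] using h

/-- **The monomial characters of `(1 + 𝔮) ∖ {0}` are linearly independent** (the functions
`λ ↦ μ(λ)⁻¹ = (∏_τ τ(λ)^{μ_τ})⁻¹` on `{λ ∈ F : λ ≠ 0, λ ∈ 1 + 𝔮}`, indexed by all exponent vectors
`μ`): `(1 + 𝔮) ∖ {0}` is a multiplicative monoid, each `λ ↦ μ(λ)⁻¹` is a character of it, distinct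
`μ` give distinct characters (`exists_mem_oneAddIdeal_prod_pow_ne`), and distinct characters are
linearly independent (Dedekind–Artin, Mathlib `linearIndependent_monoidHom`). [folklore] -/
theorem linearIndependent_inv_monomial {q : Ideal (𝓞 F)} (hq : q ≠ ⊥) :
    LinearIndependent ℂ fun (μ : (F →+* ℂ) → ℕ)
      (x : {x : F // x ≠ 0 ∧ ∃ a ∈ q, x = 1 + (a : F)}) =>
        (∏ τ : F →+* ℂ, τ (x : F) ^ μ τ)⁻¹ := by
  classical
  -- the monoid `(1 + 𝔮) ∖ {0}`
  let S : Submonoid F :=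
    { carrier := {x : F | x ≠ 0 ∧ ∃ a ∈ q, x = 1 + (a : F)}
      one_mem' := ⟨one_ne_zero, 0, q.zero_mem, by simp⟩
      mul_mem' := by
        rintro x y ⟨hx, a, ha, rfl⟩ ⟨hy, c, hc, rfl⟩
        refine ⟨mul_ne_zero hx hy, a + c + a * c,
          q.add_mem (q.add_mem ha hc) (q.mul_mem_left a hc), ?_⟩
        push_cast
        ring }
  -- the characters
  let χ : ((F →+* ℂ) → ℕ) → (S →* ℂ) := fun μ =>
    { toFun := fun x => (∏ τ : F →+* ℂ, τ (x : F) ^ μ τ)⁻¹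
      map_one' := by simp
      map_mul' := fun x y => by
        simp only [Submonoid.coe_mul, map_mul, mul_pow, Finset.prod_mul_distrib, mul_inv] }
  have hχ : Function.Injective χ := by
    intro μ μ' h
    by_contra hne
    obtain ⟨x, hx0, hxq, hx⟩ := exists_mem_oneAddIdeal_prod_pow_ne hq hne
    have hx' := DFunLike.congr_fun h ⟨x, hx0, hxq⟩
    exact hx (inv_injective hx')
  have h := (linearIndependent_monoidHom S ℂ).comp χ hχ
  exact h

/-! ### Lemma 5.3 -/

/-- **Booker–Krishnamurthy 2011, Lemma 5.3 (p. 694), for an arbitrary finite set of monomials.**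
Let `F` be a number field, `𝔮 ⊆ 𝓞 F` a non-zero ideal, `R` a finite set of monomials in the
`[F : ℚ]` embedding variables (exponent vectors `μ : (F →+* ℂ) → ℕ`, `μ(λ) = ∏_τ τ(λ)^{μ_τ}`) and
`μ₀ ∈ R`. Then there are a finite set `T ⊂ (1 + 𝔮) ∩ F^×` and coefficients `c_λ ∈ ℂ` (`λ ∈ T`)
with `∑_{λ ∈ T} c_λ μ(λ)⁻¹ = 1` if `μ = μ₀` and `= 0` if `μ ≠ μ₀`, for all `μ ∈ R`. (Printed for
`R = R_M`, the monomials of total degree `< M`; see `lemma_5_3` for that literal form. Proof: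
`linearIndependent_inv_monomial` and `exists_finsupp_combination_eq_ite_of_linearIndependent`.)
[cite: BookerKrishnamurthy2011, Lemma 5.3 (p. 694)] -/
theorem exists_finset_sum_mul_inv_monomial_eq_ite {q : Ideal (𝓞 F)} (hq : q ≠ ⊥)
    (R : Finset ((F →+* ℂ) → ℕ)) {μ₀ : (F →+* ℂ) → ℕ} (hμ₀ : μ₀ ∈ R) :
    ∃ (T : Finset F) (c : F → ℂ),
      (∀ x ∈ T, x ≠ 0 ∧ ∃ a ∈ q, x = 1 + (a : F)) ∧
      ∀ μ ∈ R, (∑ x ∈ T, c x * (∏ τ : F →+* ℂ, τ x ^ μ τ)⁻¹) = if μ = μ₀ then 1 else 0 := by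
  classical
  -- restrict the independent family to the finite index set `R`
  have hli := (linearIndependent_inv_monomial hq).comp (fun μ : R => (μ : (F →+* ℂ) → ℕ))
    Subtype.val_injective
  obtain ⟨c, hc⟩ := exists_finsupp_combination_eq_ite_of_linearIndependent hli ⟨μ₀, hμ₀⟩
  refine ⟨c.support.map ⟨Subtype.val, Subtype.val_injective⟩,
    fun x => if hx : x ≠ 0 ∧ ∃ a ∈ q, x = 1 + (a : F) then c ⟨x, hx⟩ else 0, ?_, ?_⟩
  · intro x hx
    rw [Finset.mem_map] at hx
    obtain ⟨y, _, rfl⟩ := hx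
    exact y.2
  · intro μ hμ
    have h := hc ⟨μ, hμ⟩
    simp only [Subtype.mk.injEq] at h
    rw [Finset.sum_map, ← h, Finsupp.sum]
    refine Finset.sum_congr rfl fun x _ => ?_
    simp only [Function.Embedding.coeFn_mk, Function.comp_apply]
    rw [dif_pos x.2]

/-- **Booker–Krishnamurthy 2011, Lemma 5.3 (p. 694), as printed.** "Let `M ∈ ℤ_{≥0}` and
`μ₀ ∈ R_M`. Then there is a finite subset `T ⊂ (1 + 𝔮) ∩ F^×` and coefficients `c_λ ∈ ℂ` for each
`λ ∈ T` such that `∑_{λ ∈ T} c_λ μ(λ)⁻¹ = 1` if `μ = μ₀`, `0` if `μ ≠ μ₀`, for all `μ ∈ R_M`",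
where `R_M` is the set of monomials `μ(y) = ∏_τ y_τ^{μ_τ}` in the `[F : ℚ]` embedding variables of
total degree `deg μ = ∑_τ μ_τ < M`, `μ(λ) = ∏_τ τ(λ)^{μ_τ}` for `λ ∈ F`, and `𝔮 ⊆ 𝓞 F` is a
non-zero ideal. [cite: BookerKrishnamurthy2011, Lemma 5.3 (p. 694)] -/
theorem lemma_5_3 {q : Ideal (𝓞 F)} (hq : q ≠ ⊥) (M : ℕ) {μ₀ : (F →+* ℂ) → ℕ}
    (hμ₀ : ∑ τ, μ₀ τ < M) :
    ∃ (T : Finset F) (c : F → ℂ),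
      (∀ x ∈ T, x ≠ 0 ∧ ∃ a ∈ q, x = 1 + (a : F)) ∧
      ∀ μ : (F →+* ℂ) → ℕ, ∑ τ, μ τ < M →
        (∑ x ∈ T, c x * (∏ τ : F →+* ℂ, τ x ^ μ τ)⁻¹) = if μ = μ₀ then 1 else 0 := by
  classical
  -- `R_M` as a finite set: exponent vectors bounded by `M` pointwise, of total degree `< M`
  set R : Finset ((F →+* ℂ) → ℕ) :=
    (Fintype.piFinset fun _ : F →+* ℂ => Finset.range M).filter fun μ => ∑ τ, μ τ < M with hR
  have hmemR : ∀ μ : (F →+* ℂ) → ℕ, ∑ τ, μ τ < M → μ ∈ R := fun μ hμ => by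
    rw [hR, Finset.mem_filter, Fintype.mem_piFinset]
    refine ⟨fun τ => Finset.mem_range.mpr (lt_of_le_of_lt ?_ hμ), hμ⟩
    exact Finset.single_le_sum (fun _ _ => Nat.zero_le _) (Finset.mem_univ τ)
  obtain ⟨T, c, hT, hc⟩ := exists_finset_sum_mul_inv_monomial_eq_ite hq R (hmemR μ₀ hμ₀)
  exact ⟨T, c, hT, fun μ hμ => hc μ (hmemR μ hμ)⟩

/-! ### The paper's density statement -/

/-- **Zariski density of `{τ(λ⁻¹) : λ ∈ (1 + 𝔮) ∩ F^×}` in `ℂ^{[F:ℚ]}`** (Booker–Krishnamurthy 2011,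
proof of Lemma 5.3, p. 695: "the set `S = {τ(λ⁻¹) : λ ∈ (1 + 𝔮) ∩ F^×}` is Zariski dense in
`ℂ^{[F:ℚ]}`", `τ = (τ₁, …, τ_{[F:ℚ]})` the canonical embedding): a complex polynomial in the
embedding variables vanishing at `(τ(λ)⁻¹)_τ` for every non-zero `λ ∈ 1 + 𝔮` is zero. Here deduced
from `linearIndependent_inv_monomial` (its value at such a point is `∑_μ coeff_μ · μ(λ)⁻¹`).
[cite: BookerKrishnamurthy2011, Lemma 5.3 (proof, p. 695)] -/
theorem mvPolynomial_eq_zero_of_forall_eval_inv_embedding_eq_zero {q : Ideal (𝓞 F)} (hq : q ≠ ⊥)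
    (P : MvPolynomial (F →+* ℂ) ℂ)
    (hP : ∀ x : F, x ≠ 0 → (∃ a ∈ q, x = 1 + (a : F)) →
      MvPolynomial.eval (fun τ : F →+* ℂ => (τ x)⁻¹) P = 0) :
    P = 0 := by
  classical
  -- independence of the monomial functions indexed by the (finitely supported) exponents
  have hli := (linearIndependent_inv_monomial hq).comp
    (fun μ : (F →+* ℂ) →₀ ℕ => (μ : (F →+* ℂ) → ℕ)) DFunLike.coe_injective
  rw [linearIndependent_iff'] at hli
  have hcoeff : ∀ μ ∈ P.support, P.coeff μ = 0 := by
    refine hli P.support (fun μ => P.coeff μ) ?_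
    funext x
    obtain ⟨x, hx0, hxq⟩ := x
    have h := hP x hx0 hxq
    rw [MvPolynomial.eval_eq] at h
    simp only [Finset.sum_apply, Pi.smul_apply, smul_eq_mul, Pi.zero_apply]
    rw [← h]
    refine Finset.sum_congr rfl fun μ _ => ?_
    congr 1
    simp only [Function.comp_apply]
    rw [← Finset.prod_inv_distrib, Finset.prod_subset (Finset.subset_univ μ.support)]
    · exact Finset.prod_congr rfl fun τ _ => (inv_pow _ _).symm
    · intro τ _ hτ
      rw [Finsupp.notMem_support_iff.mp hτ, pow_zero]
  ext μ
  by_cases hμ : μ ∈ P.support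
  · simpa using hcoeff μ hμ
  · simpa [MvPolynomial.mem_support_iff] using hμ

end BookerKrishnamurthy

end Literature.NumberTheory.Automorphic

end
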